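import Literature.NumberTheory.Automorphic.AutomorphicRepsGLCuspidalL2Step2
import Literature.NumberTheory.Automorphic.AutomorphicFormsStableHolds
import Literature.NumberTheory.Automorphic.AutomorphyDatumGLRegular
import Literature.NumberTheory.Automorphic.AutomorphicFormsL2DerivativeIntegral
import Literature.NumberTheory.Automorphic.AutomorphicRepsGLCuspFormsSquareIntegrable
import HarnessLib

/-!
# The `L²` side of Step 2 of Borel–Jacquet 4.6 for `GL_n` holds for every closed invariant `Π`:
# discharge of `AutomorphicRepsGL.exists_toLp_mem_invQuot_eq_lieDeriv`

Topic `NumberTheory/Automorphic`; sibling proof file of `AutomorphicRepsGLCuspidalL2Step2` on its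
named fact `AutomorphicRepsGL.exists_toLp_mem_invQuot_eq_lieDeriv hcpt μ` (fact 2 of Step 2 of
Borel–Jacquet 1979, 4.6 for `GL_n`; Borel 1972, Cor. 3.19–3.21): for a CLOSED `GL_n(𝔸_K)`-INVARIANT
subspace `Π ≤ L²(GL_n(𝔸_K) ⧸ A_G GL_n(K), μ)` (not necessarily cuspidal, not necessarily
irreducible), `f ∈ ℒ²(μ)` with `[f] ∈ Π` such that `φ = invQuot f = (g ↦ f [g⁻¹])` is an automorphic
form, and `X ∈ 𝔤𝔩_n(K_∞)`, there is `f_X ∈ ℒ²(μ)` with `[f_X] ∈ Π` and `invQuot f_X = X φ`.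

In print (`[f]` is a differentiable vector because `φ = φ ∗ α`, Harish-Chandra 1966 / Borel 1972,
Thm. 3.18) this rests on Harish-Chandra's convolution identity, from which the sibling files
`HarishChandraL2GL`, `HarishChandraStep2GL`, `HarishChandraDiracGL` derive it conditionally; the
sibling `AutomorphicRepsGLCuspidalL2Step2Holds` proves the case `Π ≤ L²_cusp` through the
boundedness of cusp forms. Here the fact is PROVED AS STATED, for every closed invariant `Π`, from two proved
ingredients of the tree:

* **interior elliptic regularity in E. Nelson's `L²` form** (`AutomorphicFormsStableHolds`, there
  used for the moderate growth of `X φ`): the same argument, with the size of the cut-off weights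
  measured by the local `L²`-norm instead of the supremum of `φ` on the chart, gives the local
  Sobolev inequality `|(X φ)(y)|² ≤ C ∫ ξ(x)² |φ(y e(x))|² dx` UNIFORMLY in the base point `y`
  (`exists_sq_norm_lieDeriv_le_integral_of_isRegular`, any regular automorphy datum), whence,
  integrating over the quotient (Tonelli) and using the invariance of `μ`, `X φ` read on the
  quotient is square integrable: `X φ = invQuot f_X` with `f_X ∈ ℒ²(μ)` continuous and
  `‖f_X‖₂² ≤ C ‖ξ‖₂² ‖f‖₂²` (`exists_memLp_invQuot_eq_lieDeriv_gl`);
* **the fundamental theorem of calculus along `exp tX` in `L²(μ)`**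
  (`hasDerivAt_rightRegular_expMem_toLp`, `AutomorphicFormsL2DerivativeIntegral`): the orbit map
  `t ↦ R(exp tX) [f]` then has `L²`-derivative `[f_X]` at `0`, so `[f_X]`, a limit of difference
  quotients of vectors of `Π`, lies in the closed subspace `Π`
  (`AutomorphicRepsGL.exists_toLp_mem_invQuot_eq_lieDeriv_holds`, **the named fact holds**).

The road taken (a local Sobolev bound from the elliptic annihilator of a `K_∞`-finite
`Z(𝔤)`-finite function) is that of the *uniform* moderate growth estimate, Borel–Jacquet 1979,
4.3 (ii) / Harish-Chandra 1966, §8, in Nelson's `L²` dress (Ann. of Math. 70 (1959), §§6–8); the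
statement discharged is Borel 1972, Cor. 3.19–3.21 for the right regular representation of
`GL_n(𝔸_K)` on `L²` of the automorphic quotient. No definitions, no named facts.

## References

* A. Borel, H. Jacquet, *Automorphic forms and automorphic representations*, Proc. Sympos. Pure
  Math. 33 (1979), part 1, 4.3 (ii) and 4.6 [BorelJacquet1979].
* A. Borel, *Représentations de groupes localement compacts*, LNM 276 (1972), Thm. 3.18,
  Cor. 3.19–3.21 [Borel1972].
* Harish-Chandra, *Discrete series for semisimple Lie groups. II*, Acta Math. 116 (1966), §8
  [HarishChandra1966]; *Representations of a semisimple Lie group on a Banach space. I*, Trans.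
  AMS 75 (1953), §§7–9 [HarishChandraTAMS1953].
* E. Nelson, *Analytic vectors*, Ann. of Math. 70 (1959), §§6–8 [Nelson1959].
-/

noncomputable section

-- (H5) `Classical`: the place subtypes indexing `mixedSpace K` are `Fintype` classically
open scoped MatrixGroups Classical
open NumberField NumberField.mixedEmbedding IsDedekindDomain
open _root_.MeasureTheory

namespace Literature.NumberTheory.Automorphic

open Set Metric Filter
open _root_.Literature.Analysis.OperatorTheory _root_.Literature.Analysis.Distribution
open scoped Matrix Topology InnerProductSpace ENNReal

/-! ### The interior `L²` estimate for Lie derivatives of automorphic forms (regular datum) -/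

section InteriorL2

open scoped ContDiff

variable {K : Type} [Field K] [NumberField K]
  {A : Type*} [NormedCommRing A] [NormedAlgebra ℝ A] [NormedAlgebra ℚ A] [CompleteSpace A]
  [StarRing A] {N : Type*} [Fintype N] [DecidableEq N]
  {𝒢 : AdelicGroupData K} {𝒟 : AutomorphyDatum 𝒢 A N}

set_option maxHeartbeats 1600000 in
/-- **Interior `L²` estimate for the Lie derivatives of an automorphic form (regular datum).**
For a regular automorphy datum over a finite-dimensional coefficient algebra with `ℝ`-linear
involution, an automorphic form `φ` and `X ∈ 𝔤`, there are exponential coordinates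
`e : ℝ^d → G_∞` (`e = chartExp B` for an adapted basis `B` of `𝔤`), a continuous compactly
supported weight `ξ` on `ℝ^d` (Nelson's envelope, `[0, 1]`-valued; only continuity and compact
support are recorded) and `C ≥ 0` such that for EVERY base point `y ∈ G(𝔸_K)`

  `|(X φ)(y)|² ≤ C ∫_{ℝ^d} |ξ(x) φ(y e(x))|² dx`,

i.e. `X φ` is bounded pointwise by the `L²`-norm of `φ` on a fixed compact neighbourhood of the
base point, uniformly in the base point. Proof: word for word that of
`HasModerateGrowth.lieDeriv_of_isRegular` (interior elliptic regularity in E. Nelson's `L²` form: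
the elliptic annihilator `IsAutomorphicForm.exists_elliptic_annihilator`, the cut-off weights of
`NelsonCutoffWeights`, the abstract interior estimate `sum_norm_weight_wordEnd_le_interiorConst`
and the frame Sobolev bound `exists_frame_pointBound`), except that the size of the weights of `φ`
at `y` is measured by the local `L²`-norm `‖[ξ · P_y φ]‖` (`norm_weightMap_le_envelope`) instead
of the supremum of `φ` on the chart. This is the local Sobolev inequality behind the *uniform*
moderate growth of automorphic forms and the square integrability of the derivatives of
square-integrable ones (Borel–Jacquet 1979, 4.3 (ii); Harish-Chandra 1966, §8, Lemma 13; Borel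
1997, 2.14 and 5.6 (c), there via `φ = φ ∗ α`). [cite: BorelJacquetCorvallis1979, 4.3 (ii)] -/
theorem exists_sq_norm_lieDeriv_le_integral_of_isRegular [FiniteDimensional ℝ A] [StarModule ℝ A]
    (h𝒟 : 𝒟.IsRegular) {φ : 𝒢.Adelic → ℂ} (hφ : IsAutomorphicForm 𝒟 φ) (X : 𝒟.arch.lie) :
    ∃ (d : ℕ) (e : (Fin d → ℝ) → 𝒟.arch.carrier) (ξ : (Fin d → ℝ) → ℝ) (C : ℝ),
      Continuous e ∧ Continuous ξ ∧ HasCompactSupport ξ ∧ 0 ≤ C ∧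
        ∀ y, ‖lieDeriv 𝒟.ofArch X φ y‖ ^ 2 ≤
          C * ∫ x, ‖((ξ x : ℝ) : ℂ) * φ (y * 𝒟.ofArch (e x))‖ ^ 2 := by
  classical
  -- `star` is `ℝ`-linear on the finite-dimensional `A`, hence continuous
  haveI : ContinuousStar A := by
    refine ⟨?_⟩
    let σ : A →ₗ[ℝ] A :=
      { toFun := star
        map_add' := star_add
        map_smul' := fun r a ↦ by rw [star_smul, star_trivial]; rfl }
    exact σ.continuous_of_finiteDimensional
  /- Step 1: the elliptic annihilator `∑ⱼ rⱼ L_B^j φ = 0`, `r_M = 1` -/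
  have htr : ∀ a : A, Algebra.trace ℝ A (star a) = Algebra.trace ℝ A a := trace_star
  have hpos : ∀ a : A, a ≠ 0 → 0 < Algebra.trace ℝ A (star a * a) := fun a ha ↦ by
    rw [mul_comm]; exact h𝒟.isStarFormallyReal.trace_mul_star_self_pos ha
  obtain ⟨d, B, Mdeg, r, hrM, hann⟩ := hφ.exists_elliptic_annihilator h𝒟 htr hpos
  /- Step 2: the exponential chart of `B` and its fields -/
  obtain ⟨Ξ, Ω₀, hΞs, hΞ0, hΩ₀, h0Ω₀, hΞ⟩ :=
    exists_chartFields (ι := 𝒟.ofArch) h𝒟.mem_lie_of_expGL_mem B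
  obtain ⟨R₀, hR₀, hballΩ⟩ := Metric.isOpen_iff.1 hΩ₀ 0 h0Ω₀
  /- Step 3: the Lie algebra representation on smooth functions and Nelson's family -/
  -- the commutator Lie ring on `End_ℂ` of the smooth functions (Mathlib's
  -- `LieRing.ofAssociativeRing`, the instance under which `ArchimedeanApplyFreeCongr` supplies `ρ`)
  letI : LieRing (Module.End ℂ (archSmooth 𝒟.ofArch)) := LieRing.ofAssociativeRing
  obtain ⟨ρ, hρ⟩ := exists_lieHom_lieDeriv (𝒟.ofArch)
  set Aop : Fin d → Module.End ℂ (archSmooth 𝒟.ofArch) := fun i ↦ ρ (basisLie B i)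
  -- the brackets `[Bᵢ, Bₘ] = ∑ₗ c_{iml} Bₗ` of `𝔤` in the basis `B`
  set eqv := lieEquivSubmodule 𝒟.arch
  set cst : Fin d → Fin d → Fin d → ℝ := fun i m l ↦
    B.repr (eqv ⁅basisLie B i, basisLie B m⁆) l
  have hbasis : ∀ Y : 𝒟.arch.lie, Y = ∑ l, (B.repr (eqv Y) l) • basisLie B l := by
    intro Y
    have h1 : eqv Y = ∑ l, (B.repr (eqv Y) l) • B l := (B.sum_repr (eqv Y)).symm
    have h2 : Y = eqv.symm (eqv Y) := (eqv.symm_apply_apply Y).symm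
    conv_lhs => rw [h2, h1, map_sum]
    refine Finset.sum_congr rfl fun l _ ↦ ?_
    rw [map_smul]
    congr 1
  have hbr : ∀ i m, Aop i * Aop m - Aop m * Aop i = ∑ l, (cst i m l : ℂ) • Aop l := by
    intro i m
    have h1 : ρ (basisLie B i) * ρ (basisLie B m) - ρ (basisLie B m) * ρ (basisLie B i) =
        ρ ⁅basisLie B i, basisLie B m⁆ := by
      rw [LieHom.map_lie, LieRing.of_associative_ring_bracket]
    change ρ (basisLie B i) * ρ (basisLie B m) - ρ (basisLie B m) * ρ (basisLie B i) =
      ∑ l, (cst i m l : ℂ) • ρ (basisLie B l)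
    rw [h1]
    conv_lhs => rw [hbasis ⁅basisLie B i, basisLie B m⁆]
    rw [map_sum]
    refine Finset.sum_congr rfl fun l _ ↦ ?_
    rw [map_smul, real_smul_end_eq_coe_smul]
  set cM : ℝ := ∑ i, ∑ m, ∑ l, |cst i m l|
  have hcM0 : 0 ≤ cM := Finset.sum_nonneg fun _ _ ↦ Finset.sum_nonneg fun _ _ ↦
    Finset.sum_nonneg fun _ _ ↦ abs_nonneg _
  have hc : ∀ i m l, |cst i m l| ≤ cM := by
    intro i m l
    calc |cst i m l| ≤ ∑ l', |cst i m l'| :=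
          Finset.single_le_sum (f := fun l' ↦ |cst i m l'|) (fun _ _ ↦ abs_nonneg _) (Finset.mem_univ l)
      _ ≤ ∑ m', ∑ l', |cst i m' l'| :=
          Finset.single_le_sum (f := fun m' ↦ ∑ l', |cst i m' l'|)
            (fun _ _ ↦ Finset.sum_nonneg fun _ _ ↦ abs_nonneg _) (Finset.mem_univ m)
      _ ≤ cM := Finset.single_le_sum (f := fun i' ↦ ∑ m', ∑ l', |cst i' m' l'|)
            (fun _ _ ↦ Finset.sum_nonneg fun _ _ ↦ Finset.sum_nonneg fun _ _ ↦ abs_nonneg _)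
            (Finset.mem_univ i)
  /- Step 4: chart expressions `P_y v = (t ↦ v (y ι(exp ∑ tᵢBᵢ)))` and their derivatives -/
  set P : 𝒢.Adelic → (archSmooth 𝒟.ofArch) →ₗ[ℂ] ((Fin d → ℝ) → ℂ) := fun y ↦
    { toFun := fun v ↦ chartFun 𝒟.ofArch B (v : 𝒢.Adelic → ℂ) y
      map_add' := fun v w ↦ rfl
      map_smul' := fun c v ↦ rfl }
  have hP_apply : ∀ y v t, P y v t = (v : 𝒢.Adelic → ℂ) (y * 𝒟.ofArch (chartExp B t)) := fun _ _ _ ↦ rfl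
  have hPs : ∀ y v, ContDiff ℝ ∞ (P y v) := fun y v ↦
    contDiff_chartFun B ((mem_archSmooth_iff _ _).1 v.2) y
  have hPA : ∀ y p v, EqOn (P y (Aop p v)) (fun x ↦ fderiv ℝ (P y v) x (Ξ p x)) (ball 0 R₀) := by
    intro y p v x hx
    change ((ρ (basisLie B p) v : archSmooth _) : 𝒢.Adelic → ℂ) (y * 𝒟.ofArch (chartExp B x)) =
      fderiv ℝ (chartFun 𝒟.ofArch B (v : 𝒢.Adelic → ℂ) y) x (Ξ p x)
    rw [hρ, fderiv_chartFun_chartField hΞ ((mem_archSmooth_iff _ _).1 v.2) y p (hballΩ hx)]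
  /- Step 5: the cut-off scale `S` and the weights -/
  set S : ℝ := min (R₀ ^ 2 / 2) 1
  have hS : 0 < S := lt_min (by positivity) one_pos
  have hSR : S < R₀ ^ 2 := (min_le_left _ _).trans_lt (by nlinarith)
  obtain ⟨D, hD0, hskew⟩ :=
    exists_skew_const Ξ hR₀.le (fun p ↦ (hΞs p).contDiffOn) hS hSR P hPs Aop hPA
  set Mw : 𝒢.Adelic → ℕ → (archSmooth 𝒟.ofArch) →ₗ[ℂ] Lp ℂ 2 (volume : Measure (Fin d → ℝ)) :=
    fun y m ↦ weightMap hS (P y) (fun v ↦ (hPs y v).continuous) m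
  /- Step 6: the relation `Δ^M f = -∑_{j<M} rⱼ Δ^j f` in `archSmooth` -/
  set f : archSmooth 𝒟.ofArch := ⟨φ, (mem_archSmooth_iff _ _).2 hφ.archSmooth⟩
  have hΔpow : ∀ j, (((laplacianEnd Aop ^ j) f : archSmooth _) : 𝒢.Adelic → ℂ) =
      (sqSumOp 𝒟.ofArch (basisLie B))^[j] φ := fun j ↦ coe_laplacianEnd_pow_apply ρ hρ (basisLie B) j f
  -- the degenerate case `M = 0`: then `φ = 0`
  by_cases hM0 : Mdeg = 0
  · subst hM0
    have hφ0 : φ = 0 := by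
      funext x
      have h := hann x
      rw [Finset.sum_range_one, hrM] at h
      simpa using h
    refine ⟨d, chartExp B, envelope S, 0, continuous_chartExp B, continuous_envelope,
      hasCompactSupport_envelope hS, le_rfl, fun y ↦ ?_⟩
    have : lieDeriv 𝒟.ofArch X φ = 0 := by
      funext g
      simp [lieDeriv, hφ0]
    rw [this, zero_mul]
    simp
  have hA₀ : 1 ≤ Mdeg := Nat.one_le_iff_ne_zero.2 hM0
  set rr : ℕ → ℂ := fun j ↦ -(r j : ℂ) with hrr
  have hR : (laplacianEnd Aop ^ Mdeg) f = ∑ i ∈ Finset.range Mdeg, rr i • (laplacianEnd Aop ^ i) f := by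
    apply Subtype.ext
    rw [hΔpow, Submodule.coe_sum]
    funext x
    rw [Finset.sum_apply]
    simp only [Submodule.coe_smul, Pi.smul_apply, smul_eq_mul, hΔpow, hrr]
    have h := hann x
    rw [Finset.sum_range_succ, hrM, Complex.ofReal_one, one_mul] at h
    rw [eq_neg_of_add_eq_zero_right h, ← Finset.sum_neg_distrib]
    refine Finset.sum_congr rfl fun j _ ↦ ?_
    ring
  set rM : ℝ := ∑ j ∈ Finset.range Mdeg, ‖(r j : ℂ)‖
  have hrM0 : 0 ≤ rM := Finset.sum_nonneg fun _ _ ↦ norm_nonneg _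
  have hr : ∀ i < Mdeg, ‖rr i‖ ≤ rM := by
    intro i hi
    rw [hrr]
    simp only [norm_neg]
    exact Finset.single_le_sum (f := fun j ↦ ‖(r j : ℂ)‖) (fun _ _ ↦ norm_nonneg _)
      (Finset.mem_range.2 hi)
  /- Step 7: the size of the weights of `f` at the base point `y`: the local `L²`-norm -/
  set a : 𝒢.Adelic → ℝ := fun y ↦ ‖(memLp_envelope_mul hS (hPs y f).continuous).toLp _‖ with ha_def
  have ha : ∀ y m, ‖Mw y m f‖ ≤ a y := fun y m ↦
    norm_weightMap_le_envelope hS (P y) (fun v ↦ (hPs y v).continuous) m f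
  /- Step 8: the interior estimate, uniformly in `y` -/
  set Kint : ℝ := interiorConst d cM D Mdeg rM (d + 2)
  have hint : ∀ y, ∀ k ≤ d + 1, ∑ w : Fin k → Fin d, ‖Mw y 0 (wordEnd Aop (List.ofFn w) f)‖ ≤
      Kint * a y := by
    intro y k hk
    have h := sum_norm_weight_wordEnd_le_interiorConst Aop cst hbr hcM0 hc (Mw y)
      (fun m v ↦ norm_weightMap_le_succ hS (P y) _ m v) hD0 (fun m i u w ↦ hskew y m i u w)
      (fun v ↦ exists_norm_weightMap_le hS (P y) _ v) hA₀ hrM0 hr hR (ha y)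
      (kmax := d + 2) (by omega) (k := k) (by omega)
    rwa [Fintype.card_fin] at h
  /- Step 9: the Sobolev radius -/
  obtain ⟨ρ₀, hρ₀, hρ₀R, hSob⟩ := exists_frame_pointBound (Vf := Ξ) hR₀ (fun p ↦ (hΞs p).contDiffOn)
    (isUnit_frameMap_zero hΞ0)
  set ϱ : ℝ := min ρ₀ (Real.sqrt (S / (2 * (d + 1))))
  have hϱ0 : 0 < ϱ := lt_min hρ₀ (Real.sqrt_pos.2 (by positivity))
  have hϱρ₀ : ϱ ≤ ρ₀ := min_le_left _ _
  obtain ⟨Csob, hCsob0, hCsob⟩ := hSob ϱ hϱ0 hϱρ₀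
  have hϱS : closedBall (0 : Fin d → ℝ) ϱ ⊆ {x | radSq x ≤ S / 2} := by
    intro x hx
    rw [mem_closedBall, dist_zero_right] at hx
    have h1 : radSq x ≤ d * ‖x‖ ^ 2 := radSq_le x
    have h2 : ‖x‖ ^ 2 ≤ ϱ ^ 2 := pow_le_pow_left₀ (norm_nonneg _) hx 2
    have h3 : ϱ ^ 2 ≤ S / (2 * (d + 1)) := by
      calc ϱ ^ 2 ≤ Real.sqrt (S / (2 * (d + 1))) ^ 2 :=
            pow_le_pow_left₀ hϱ0.le (min_le_right _ _) 2
        _ = S / (2 * (d + 1)) := Real.sq_sqrt (by positivity)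
    have hd : (0 : ℝ) ≤ d := Nat.cast_nonneg d
    change radSq x ≤ S / 2
    calc radSq x ≤ d * ϱ ^ 2 := h1.trans (mul_le_mul_of_nonneg_left h2 hd)
      _ ≤ d * (S / (2 * (d + 1))) := mul_le_mul_of_nonneg_left h3 hd
      _ ≤ ((d : ℝ) + 1) * (S / (2 * (d + 1))) :=
          mul_le_mul_of_nonneg_right (by linarith) (by positivity)
      _ = S / 2 := by field_simp
  have hϱΩ : closedBall (0 : Fin d → ℝ) ϱ ⊆ Ω₀ :=
    ((closedBall_subset_ball (hϱρ₀.trans_lt hρ₀R)).trans hballΩ)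
  /- Step 10: the coordinates of `X` and the final bound -/
  set xc : Fin d → ℝ := fun p ↦ B.repr (eqv X) p
  set xM : ℝ := ∑ p, ‖(xc p : ℂ)‖
  have hxM0 : 0 ≤ xM := Finset.sum_nonneg fun _ _ ↦ norm_nonneg _
  have hρX : ρ X f = ∑ p, (xc p : ℂ) • Aop p f := by
    conv_lhs => rw [hbasis X, map_sum, LinearMap.sum_apply]
    refine Finset.sum_congr rfl fun p _ ↦ ?_
    rw [map_smul, real_smul_end_eq_coe_smul, LinearMap.smul_apply]
  refine ⟨d, chartExp B, envelope S, (Csob * ((d + 1) * (xM * Kint))) ^ 2, continuous_chartExp B,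
    continuous_envelope, hasCompactSupport_envelope hS, sq_nonneg _, fun y ↦ ?_⟩
  -- the chart expression of `X φ` at `y` and its value at `0`
  set F : (Fin d → ℝ) → ℂ := P y (ρ X f) with hF
  have hF0 : F 0 = lieDeriv 𝒟.ofArch X φ y := by
    rw [hF, hP_apply, chartExp_zero, map_one, mul_one, hρ]
  have hFs : ContDiff ℝ ∞ F := hPs y _
  -- words of `F` in the chart are chart expressions of operator words
  have hword : ∀ (k : ℕ) (w : Fin k → Fin d),
      (∫ x in closedBall (0 : Fin d → ℝ) ϱ, ‖vfWord Ξ (List.ofFn w) F x‖ ^ (2 : ℝ)) ^ (1 / 2 : ℝ) ≤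
        xM * ∑ p, ‖Mw y 0 (wordEnd Aop (List.ofFn (Fin.snoc w p : Fin (k + 1) → Fin d)) f)‖ := by
    intro k w
    have heq : EqOn (vfWord Ξ (List.ofFn w) F)
        (P y (wordEnd Aop (List.ofFn w) (ρ X f))) (closedBall 0 ϱ) := fun x hx ↦
      vfWord_chartFun_eqOn hΩ₀ hΞ ρ hρ y (List.ofFn w) (ρ X f) (hϱΩ hx)
    rw [setIntegral_congr_fun measurableSet_closedBall (fun x hx ↦ by rw [heq hx])]
    refine (rpow_setIntegral_le_norm_weightMap hS (P y) (fun v ↦ (hPs y v).continuous) hϱS _).trans ?_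
    change ‖Mw y 0 (wordEnd Aop (List.ofFn w) (ρ X f))‖ ≤ _
    rw [hρX, wordEnd_apply_sum_smul, map_sum]
    refine (norm_sum_le _ _).trans ?_
    rw [Finset.mul_sum]
    refine Finset.sum_le_sum fun p _ ↦ ?_
    rw [map_smul, _root_.norm_smul, ← ofFn_snoc]
    refine mul_le_mul_of_nonneg_right ?_ (norm_nonneg _)
    exact Finset.single_le_sum (f := fun p ↦ ‖(xc p : ℂ)‖) (fun _ _ ↦ norm_nonneg _) (Finset.mem_univ p)
  -- the local `L²`-norm at `y` as an integral
  have ha_eq : a y ^ 2 = ∫ x, ‖((envelope S x : ℝ) : ℂ) * φ (y * 𝒟.ofArch (chartExp B x))‖ ^ 2 := by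
    have h1 : a y = (∫ x, ‖((envelope S x : ℝ) : ℂ) * φ (y * 𝒟.ofArch (chartExp B x))‖ ^ (2 : ℝ)) ^
        (1 / 2 : ℝ) :=
      norm_toLp_eq_rpow _
    rw [h1, ← Real.sqrt_eq_rpow, Real.sq_sqrt (integral_nonneg fun x ↦ by positivity)]
    simp_rw [Real.rpow_two]
  -- assemble
  have hmain : ‖F 0‖ ≤ Csob * ((d + 1) * (xM * Kint)) * a y := by
    refine (hCsob F hFs).trans ?_
    have hk : ∀ k ∈ Finset.range (d + 1), ∑ w : Fin k → Fin d,
        (∫ x in closedBall (0 : Fin d → ℝ) ϱ, ‖vfWord Ξ (List.ofFn w) F x‖ ^ (2 : ℝ)) ^ (1 / 2 : ℝ) ≤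
          xM * (Kint * a y) := by
      intro k hk
      have hk' : k + 1 ≤ d + 1 := by have := Finset.mem_range.1 hk; omega
      calc ∑ w : Fin k → Fin d, (∫ x in closedBall (0 : Fin d → ℝ) ϱ, ‖vfWord Ξ (List.ofFn w) F x‖ ^ (2 : ℝ)) ^ (1 / 2 : ℝ)
          ≤ ∑ w : Fin k → Fin d, xM * ∑ p, ‖Mw y 0 (wordEnd Aop (List.ofFn (Fin.snoc w p : Fin (k + 1) → Fin d)) f)‖ :=
            Finset.sum_le_sum fun w _ ↦ hword k w
        _ = xM * ∑ w' : Fin (k + 1) → Fin d, ‖Mw y 0 (wordEnd Aop (List.ofFn w') f)‖ := by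
            have hsn := sum_sum_snoc_eq
              (fun w' : Fin (k + 1) → Fin d ↦ ‖Mw y 0 (wordEnd Aop (List.ofFn w') f)‖)
            rw [← Finset.mul_sum, hsn]
        _ ≤ xM * (Kint * a y) := mul_le_mul_of_nonneg_left (hint y (k + 1) hk') hxM0
    calc Csob * ∑ k ∈ Finset.range (d + 1), ∑ w : Fin k → Fin d,
          (∫ x in closedBall (0 : Fin d → ℝ) ϱ, ‖vfWord Ξ (List.ofFn w) F x‖ ^ (2 : ℝ)) ^ (1 / 2 : ℝ)
        ≤ Csob * ∑ _k ∈ Finset.range (d + 1), xM * (Kint * a y) :=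
          mul_le_mul_of_nonneg_left (Finset.sum_le_sum hk) hCsob0
      _ = Csob * ((d + 1) * (xM * Kint)) * a y := by
          rw [Finset.sum_const, Finset.card_range, nsmul_eq_mul]
          push_cast
          ring
  calc ‖lieDeriv 𝒟.ofArch X φ y‖ ^ 2 = ‖F 0‖ ^ 2 := by rw [hF0]
    _ ≤ (Csob * ((d + 1) * (xM * Kint)) * a y) ^ 2 := pow_le_pow_left₀ (norm_nonneg _) hmain 2
    _ = (Csob * ((d + 1) * (xM * Kint))) ^ 2 * a y ^ 2 := by ring
    _ = _ := by rw [ha_eq]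

end InteriorL2

/-! ### Fact 2 for `GL_n`: square integrability of `X φ` and membership of `[X φ]` in `Π` -/

section Fact46Holds

variable {n : ℕ} {K : Type} [Field K] [NumberField K] {hcpt : isCompact_glFiniteIntegralLevel n K}
  {μ : Measure (AdelicGroupData.gl n K).automorphicQuotient}
  [(AdelicGroupData.gl n K).IsAutomorphicMeasure μ]

/-- **Lie derivatives of square-integrable automorphic forms on `GL_n(𝔸_K)` are square
integrable.** Let `f ∈ ℒ²(GL_n(𝔸_K) ⧸ A_G GL_n(K), μ)` be such that `φ = invQuot f = (g ↦ f [g⁻¹])`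
is an automorphic form, and `X ∈ 𝔤𝔩_n(K_∞)`. Then `X φ = invQuot f_X` for a continuous
`f_X ∈ ℒ²(μ)`: `X φ` is continuous (an automorphic form, `IsAutomorphicForm.lieDeriv_of` with
`HasModerateGrowth.lieDeriv_of_isRegular`) and left invariant under `A_G · GL_n(K)`, so it descends
to a continuous `f_X` on the quotient (`AdelicGroupData.descend`); by the interior estimate
`exists_sq_norm_lieDeriv_le_integral_of_isRegular`,
`|f_X [g]|² = |(X φ)(g⁻¹)|² ≤ C ∫ ξ(x)² |f (e(x)⁻¹ • [g])|² dx`, and integrating over the quotient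
(Tonelli, invariance of `μ`) gives `‖f_X‖₂² ≤ C ‖ξ‖₂² ‖f‖₂² < ∞`. In print this is read off
Harish-Chandra's `X φ = φ ∗ α_X` (Borel 1972, Cor. 3.20–3.21; Borel–Jacquet 1979, 4.6); here it
is the `L²` form of the uniform moderate growth argument (Borel–Jacquet 1979, 4.3 (ii)).
[cite: BorelJacquet1979, 4.3 (ii) and 4.6] -/
theorem exists_memLp_invQuot_eq_lieDeriv_gl
    (f : (AdelicGroupData.gl n K).automorphicQuotient → ℂ) (hf : MemLp f 2 μ)
    (hφ : IsAutomorphicForm (AutomorphyDatum.gl n K hcpt) (invQuot (AdelicGroupData.gl n K) f))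
    (X : (AutomorphyDatum.gl n K hcpt).arch.lie) :
    ∃ f' : (AdelicGroupData.gl n K).automorphicQuotient → ℂ, MemLp f' 2 μ ∧ Continuous f' ∧
      invQuot (AdelicGroupData.gl n K) f' =
        lieDeriv (AutomorphyDatum.gl n K hcpt).ofArch X (invQuot (AdelicGroupData.gl n K) f) := by
  set φ := invQuot (AdelicGroupData.gl n K) f with hφ_def
  have hreg := AutomorphyDatum.isRegular_gl hcpt
  set ψ := lieDeriv (AutomorphyDatum.gl n K hcpt).ofArch X φ with hψ_def
  -- `X φ` is an automorphic form, hence continuous; `φ` and `f` are continuous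
  have hψaut : IsAutomorphicForm (AutomorphyDatum.gl n K hcpt) ψ :=
    hφ.lieDeriv_of (fun _ hφ' X' ↦ HasModerateGrowth.lieDeriv_of_isRegular hreg hφ' X') X
  have hψc : Continuous ψ := hψaut.continuous_gl
  have hfc : Continuous f := continuous_of_continuous_invQuot hφ.continuous_gl
  -- left invariance under `A_G · GL_n(K)` and descent
  have hφinv : ∀ γ ∈ (AdelicGroupData.gl n K).quotientSubgroup, ∀ g, φ (γ * g) = φ g :=
    fun γ hγ g ↦ invQuot_mul_left _ f hγ g
  have hψinv : ∀ γ ∈ (AdelicGroupData.gl n K).quotientSubgroup, ∀ g, ψ (γ * g) = ψ g := by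
    intro γ hγ g
    simp only [hψ_def, lieDeriv, mul_assoc, hφinv γ hγ]
  set fX := (AdelicGroupData.gl n K).descend ψ hψinv with hfX_def
  have hfXinv : invQuot (AdelicGroupData.gl n K) fX = ψ :=
    (AdelicGroupData.gl n K).invQuot_descend ψ hψinv
  have hfXc : Continuous fX := continuous_of_continuous_invQuot (by rw [hfXinv]; exact hψc)
  refine ⟨fX, ?_, hfXc, hfXinv⟩
  -- the interior estimate
  obtain ⟨d, e, ξ, C, he, hξc, hξs, hC0, hest⟩ :=
    exists_sq_norm_lieDeriv_le_integral_of_isRegular hreg hφ X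
  -- the translates `h(x) = (e(x), 1) ∈ GL_n(𝔸_K)`
  obtain ⟨h, hh⟩ : ∃ h : (Fin d → ℝ) → (AdelicGroupData.gl n K).Adelic,
      ∀ x, (AutomorphyDatum.gl n K hcpt).ofArch (e x) = h x := ⟨_, fun _ ↦ rfl⟩
  have hhc : Continuous h := by
    rw [show h = fun x ↦ (AutomorphyDatum.gl n K hcpt).ofArch (e x) from funext fun x ↦ (hh x).symm]
    exact (AutomorphyDatum.gl n K hcpt).continuous_ofArch.comp he
  simp only [hh] at hest
  -- the integrand on the product `(GL_n(𝔸_K) ⧸ A_G GL_n(K)) × ℝ^d`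
  have hΨc : Continuous fun p : (AdelicGroupData.gl n K).automorphicQuotient × (Fin d → ℝ) ↦
      ((ξ p.2 : ℝ) : ℂ) * f ((h p.2)⁻¹ • p.1) :=
    (Complex.continuous_ofReal.comp (hξc.comp continuous_snd)).mul
      (hfc.comp (((hhc.comp continuous_snd).inv).smul continuous_fst))
  have hΦm : AEMeasurable (Function.uncurry
      fun (q : (AdelicGroupData.gl n K).automorphicQuotient) (x : Fin d → ℝ) ↦
        ‖((ξ x : ℝ) : ℂ) * f ((h x)⁻¹ • q)‖ₑ ^ 2) (μ.prod volume) := by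
    refine (Continuous.measurable ?_).aemeasurable
    exact (ENNReal.continuous_pow 2).comp (continuous_enorm.comp hΨc)
  -- the pointwise bound on the quotient
  have hpt : ∀ q, ENNReal.ofReal (‖fX q‖ ^ 2) ≤
      ENNReal.ofReal C * ∫⁻ x, ‖((ξ x : ℝ) : ℂ) * f ((h x)⁻¹ • q)‖ₑ ^ 2 := by
    intro q
    have hsurj : Function.Surjective (AdelicGroupData.gl n K).toAutomorphicQuotient :=
      QuotientGroup.mk_surjective
    obtain ⟨g, rfl⟩ := hsurj q
    -- the integrand `F(x) = ξ(x) f (e(x)⁻¹ • [g]) = ξ(x) φ (g⁻¹ e(x))`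
    set F : (Fin d → ℝ) → ℂ :=
      fun x ↦ ((ξ x : ℝ) : ℂ) * f ((h x)⁻¹ • (AdelicGroupData.gl n K).toAutomorphicQuotient g)
      with hF_def
    have e0 : fX ((AdelicGroupData.gl n K).toAutomorphicQuotient g) = ψ g⁻¹ := rfl
    have e1 : ∀ x, φ (g⁻¹ * h x) = f ((h x)⁻¹ • (AdelicGroupData.gl n K).toAutomorphicQuotient g) :=
        fun x ↦ by
      have h1 := apply_inv_smul_toAutomorphicQuotient_inv f (h x) g⁻¹
      rw [inv_inv] at h1
      exact h1.symm
    have hcs : HasCompactSupport F := (hξs.comp_left Complex.ofReal_zero).mul_right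
    have hxc : Continuous F := hΨc.comp (continuous_const.prodMk continuous_id)
    have hmemx : MemLp F 2 volume := hxc.memLp_of_hasCompactSupport hcs
    have hint_x : Integrable (fun x ↦ ‖F x‖ ^ 2) volume :=
      (memLp_two_iff_integrable_sq_norm hmemx.1).1 hmemx
    have h2 : ‖fX ((AdelicGroupData.gl n K).toAutomorphicQuotient g)‖ ^ 2 ≤ C * ∫ x, ‖F x‖ ^ 2 := by
      rw [e0]
      have h3 := hest g⁻¹
      simp_rw [e1] at h3
      exact h3
    calc ENNReal.ofReal (‖fX ((AdelicGroupData.gl n K).toAutomorphicQuotient g)‖ ^ 2)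
        ≤ ENNReal.ofReal (C * ∫ x, ‖F x‖ ^ 2) := ENNReal.ofReal_le_ofReal h2
      _ = ENNReal.ofReal C * ENNReal.ofReal (∫ x, ‖F x‖ ^ 2) := ENNReal.ofReal_mul hC0
      _ = ENNReal.ofReal C * ∫⁻ x, ‖F x‖ₑ ^ 2 := by
          rw [ofReal_integral_eq_lintegral_ofReal hint_x
            (Eventually.of_forall fun x ↦ by simp only [Pi.zero_apply]; positivity)]
          congr 1
          refine lintegral_congr fun x ↦ ?_
          rw [ENNReal.ofReal_pow (norm_nonneg _), ofReal_norm]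
  -- `‖f‖₂² < ∞` and `‖ξ‖₂² < ∞`
  have hf2 : ∫⁻ q, ‖f q‖ₑ ^ 2 ∂μ < ∞ := by
    have hi : ∫⁻ q, ‖‖f q‖ ^ 2‖ₑ ∂μ < ∞ :=
      ((memLp_two_iff_integrable_sq_norm hf.1).1 hf).hasFiniteIntegral
    refine lt_of_le_of_lt (le_of_eq (lintegral_congr fun q ↦ ?_)) hi
    rw [Real.enorm_eq_ofReal (sq_nonneg _), ENNReal.ofReal_pow (norm_nonneg _), ofReal_norm]
  have hξ2 : ∫⁻ x, ‖((ξ x : ℝ) : ℂ)‖ₑ ^ 2 < ∞ := by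
    have hmemξ : MemLp (fun x ↦ ((ξ x : ℝ) : ℂ)) 2 volume :=
      (Complex.continuous_ofReal.comp hξc).memLp_of_hasCompactSupport
        (hξs.comp_left Complex.ofReal_zero)
    have hi : ∫⁻ x, ‖‖((ξ x : ℝ) : ℂ)‖ ^ 2‖ₑ < ∞ :=
      ((memLp_two_iff_integrable_sq_norm hmemξ.1).1 hmemξ).hasFiniteIntegral
    refine lt_of_le_of_lt (le_of_eq (lintegral_congr fun x ↦ ?_)) hi
    rw [Real.enorm_eq_ofReal (sq_nonneg _), ENNReal.ofReal_pow (norm_nonneg _), ofReal_norm]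
  -- the inner integral over the quotient, by invariance of `μ`
  have hmeas : Measurable fun q : (AdelicGroupData.gl n K).automorphicQuotient ↦ ‖f q‖ₑ ^ 2 :=
    ((ENNReal.continuous_pow 2).comp (continuous_enorm.comp hfc)).measurable
  have hinner : ∀ x, ∫⁻ q, ‖((ξ x : ℝ) : ℂ) * f ((h x)⁻¹ • q)‖ₑ ^ 2 ∂μ =
      ‖((ξ x : ℝ) : ℂ)‖ₑ ^ 2 * ∫⁻ q, ‖f q‖ₑ ^ 2 ∂μ := by
    intro x
    calc ∫⁻ q, ‖((ξ x : ℝ) : ℂ) * f ((h x)⁻¹ • q)‖ₑ ^ 2 ∂μ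
        = ∫⁻ q, ‖((ξ x : ℝ) : ℂ)‖ₑ ^ 2 * ‖f ((h x)⁻¹ • q)‖ₑ ^ 2 ∂μ := by
          refine lintegral_congr fun q ↦ ?_
          rw [enorm_mul, mul_pow]
      _ = ‖((ξ x : ℝ) : ℂ)‖ₑ ^ 2 * ∫⁻ q, ‖f ((h x)⁻¹ • q)‖ₑ ^ 2 ∂μ :=
          lintegral_const_mul' _ _ (ENNReal.pow_ne_top enorm_ne_top)
      _ = ‖((ξ x : ℝ) : ℂ)‖ₑ ^ 2 * ∫⁻ q, ‖f q‖ₑ ^ 2 ∂μ := by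
          congr 1
          exact (measurePreserving_smul (h x)⁻¹ μ).lintegral_comp hmeas
  -- Tonelli
  have htot : ∫⁻ q, ENNReal.ofReal (‖fX q‖ ^ 2) ∂μ < ∞ := by
    calc ∫⁻ q, ENNReal.ofReal (‖fX q‖ ^ 2) ∂μ
        ≤ ∫⁻ q, ENNReal.ofReal C *
            (∫⁻ x, ‖((ξ x : ℝ) : ℂ) * f ((h x)⁻¹ • q)‖ₑ ^ 2) ∂μ :=
          lintegral_mono hpt
      _ = ENNReal.ofReal C *
            ∫⁻ q, (∫⁻ x, ‖((ξ x : ℝ) : ℂ) * f ((h x)⁻¹ • q)‖ₑ ^ 2) ∂μ :=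
          lintegral_const_mul' _ _ ENNReal.ofReal_ne_top
      _ = ENNReal.ofReal C *
            ∫⁻ x, ∫⁻ q, ‖((ξ x : ℝ) : ℂ) * f ((h x)⁻¹ • q)‖ₑ ^ 2 ∂μ := by
          rw [lintegral_lintegral_swap hΦm]
      _ = ENNReal.ofReal C * ∫⁻ x, ‖((ξ x : ℝ) : ℂ)‖ₑ ^ 2 * ∫⁻ q, ‖f q‖ₑ ^ 2 ∂μ := by
          simp_rw [hinner]
      _ = ENNReal.ofReal C * ((∫⁻ x, ‖((ξ x : ℝ) : ℂ)‖ₑ ^ 2) * ∫⁻ q, ‖f q‖ₑ ^ 2 ∂μ) := by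
          rw [lintegral_mul_const' _ _ hf2.ne]
      _ < ∞ := ENNReal.mul_lt_top ENNReal.ofReal_lt_top (ENNReal.mul_lt_top hξ2 hf2)
  -- conclusion
  refine (memLp_two_iff_integrable_sq_norm hfXc.aestronglyMeasurable).2 ⟨?_, ?_⟩
  · exact (hfXc.norm.pow 2).aestronglyMeasurable
  · exact (hasFiniteIntegral_iff_ofReal (Eventually.of_forall fun q ↦ sq_nonneg _)).2 htot

/-- **Fact 2 of Step 2 of Borel–Jacquet 4.6 for `GL_n` holds** (discharge of the named fact
`AutomorphicRepsGL.exists_toLp_mem_invQuot_eq_lieDeriv hcpt μ`): for a closed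
`GL_n(𝔸_K)`-invariant subspace `Π ≤ L²(GL_n(𝔸_K) ⧸ A_G GL_n(K), μ)`, `f ∈ ℒ²(μ)` with `[f] ∈ Π` and
`φ = invQuot f` automorphic, and `X ∈ 𝔤𝔩_n(K_∞)`, there is `f_X ∈ ℒ²(μ)` with `[f_X] ∈ Π` and
`invQuot f_X = X φ`. By `exists_memLp_invQuot_eq_lieDeriv_gl`, `X φ = invQuot f_X` with
`f_X ∈ ℒ²(μ)`; by `hasDerivAt_rightRegular_expMem_toLp` (the fundamental theorem of calculus along
`exp tX` in `L²(μ)`) the orbit map `t ↦ R(exp tX) [f]` has `L²`-derivative `[f_X]` at `t = 0`, so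
`[f_X]` is the limit of the difference quotients `t⁻¹ (R(exp tX) [f] - [f]) ∈ Π` and lies in the
closed subspace `Π`. In print: Borel 1972, Cor. 3.19–3.21 (via Harish-Chandra's `φ = φ ∗ α`);
Borel–Jacquet 1979, 4.6; here the differentiability of `[f]` comes from interior elliptic
regularity instead. [cite: Borel1972, Cor. 3.19 and 3.21] [cite: BorelJacquet1979, 4.6] -/
theorem AutomorphicRepsGL.exists_toLp_mem_invQuot_eq_lieDeriv_holds :
    AutomorphicRepsGL.exists_toLp_mem_invQuot_eq_lieDeriv hcpt μ := by
  intro P f hf hfP hφ X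
  obtain ⟨f', hf', -, hf'eq⟩ := exists_memLp_invQuot_eq_lieDeriv_gl f hf hφ X
  refine ⟨f', hf', ?_, hf'eq⟩
  have hD := hasDerivAt_rightRegular_expMem_toLp (AutomorphyDatum.gl n K hcpt) hf hf' hφ.archSmooth
    X hf'eq.symm
  rw [hasDerivAt_iff_tendsto_slope] at hD
  refine P.isClosed.mem_of_tendsto hD (Eventually.of_forall fun t ↦ ?_)
  rw [slope_def_module]
  exact (ContRepresentation.ClosedSubrep.mem_toSubmodule).mp (P.toSubmodule.smul_of_tower_mem _
    (P.toSubmodule.sub_mem (P.apply_mem _ hfP) (P.apply_mem _ hfP)))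

end Fact46Holds

end Literature.NumberTheory.Automorphic
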